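import Literature.RepresentationTheory.ClassicalInvariants.TwoRowSl2Invariance
import Mathlib.LinearAlgebra.Matrix.Adjugate
import Mathlib.LinearAlgebra.Matrix.Trace
import Mathlib.Algebra.MvPolynomial.Monad
import Mathlib.Algebra.MvPolynomial.Funext
import Mathlib.FieldTheory.IsAlgClosed.Basic
import HarnessLib

/-!
# Semi-invariants of 4-tuples of `2 × 2` matrices under `SL₂ × SL₂ × U₄`: parity and multiplicity one

Topic `Literature/RepresentationTheory/ClassicalInvariants`. THEOREMS and model definitions only (no
named fact, no instance; D-0026). This is the invariant theory behind the rectangular Kronecker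
coefficients `g((δ,δ), (δ,δ), π)` (L. Manivel, *On the asymptotics of Kronecker coefficients* /
arXiv:0809.3710, the case `n = 2`; quoted as Prop. 8.1 of Bürgisser–Landsberg–Manivel–Weyman 2011,
§8.3): by the highest-weight-vector description of Kronecker coefficients (the tree's
`Literature.NumberTheory.DiophantineGeometry.KroneckerTriplePoly`), `g((δ,δ),(δ,δ),π)` is the
dimension of the space of polynomials `Q` on 4-tuples `(x₀, x₁, x₂, x₃)` of `2 × 2` matrices
(`x_j = (X_{((l,i),j)})_{l,i}`) which are

* fixed by `x_j ↦ g x_j` and by `x_j ↦ x_j g` for all `g ∈ SL₂(k)` (`subst₁`, `subst₂`; this is where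
  the weight `(δ, δ)` in the first two legs enters, through `TwoRowSl2Invariance`),
* fixed by the column shears `x_b ↦ x_b + t x_a`, `a < b` (`shear₃`; the unipotent radical of the
  Borel subgroup of `GL₄` acting on the tuple index),
* multihomogeneous of multidegree `π = (π₀, π₁, π₂, π₃)` in `(x₀, x₁, x₂, x₃)` (`colWt`).

**Theorem A (parity, `parity_of_ne_zero`).** Over an algebraically closed field of characteristic
`0`, if such a `Q` is nonzero then `π₀ ≡ π₁ ≡ π₂ ≡ π₃ (mod 2)`.

**Theorem B (multiplicity one, `exists_smul_eq_of_semiInvariant`).** Two such polynomials with the same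
`π` are linearly dependent.

(The third statement of Manivel's theorem, EXISTENCE for admissible `π`, is cheaper on the
Kronecker side by the semigroup property and is done in the consumer file
`Literature.Computability.AlgebraicComplexity.BLMW11RectangleTwoKroneckerProofs`.)

## Proof (ours; the printed proof computes the algebra of `U`-invariants)

`SL₂ × SL₂` acting by `z ↦ P z R` on `M₂(k) ≅ k⁴` preserves the polarised determinant
`B(y, z) = det(y + z) - det y - det z = tr(adj(y) z)` (it is the spin double cover of `SO₄`).
1. *Gram–Schmidt* (`gs`): by column shears and column scalings — which change `Q(x)` by a nonzero
   factor only (`eval_gs`) — a generic tuple is replaced by a `B`-orthogonal tuple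
   `(z₀, z₁, z₂, z₃)` of anisotropic matrices (denominator-free Gram–Schmidt, `B_gs_eq_zero`).
2. *Sign flips* (`eval_flip`): for `B`-orthogonal `z₀, z_c, z` with `det z₀ det z_c ≠ 0` the pair
   `(P, R) = (γ⁻¹ z_c adj z₀, γ⁻¹ adj z_c z₀)`, `γ² = det z₀ det z_c`, lies in `SL₂ × SL₂`, fixes `z₀`
   and `z_c` and NEGATES every `z` orthogonal to both (the `2 × 2` identity `flip_identity`:
   `z_c adj(z₀) z adj(z_c) z₀ = -det z₀ det z_c · z` modulo `B(z₀,z_c)`, `B(z₀,z)`, `B(z_c,z)`).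
   Comparing with multihomogeneity, `Q(z) (1 - (-1)^{π_a + π_b}) = 0` for each pair
   `{a, b} ⊆ {1, 2, 3}`, and `(-1, 1) ∈ SL₂ × SL₂` gives `Σ π_j` even; so `Q` vanishes at every generic
   tuple unless all parities agree, hence `Q = 0` (`MvPolynomial.funext` after multiplying by the
   polynomial `discr` expressing genericity).
3. *Normal form* (`exists_normalForm`, `exists_nf_eq_testTuple`): a generic orthogonal tuple is moved
   by `SL₂ × SL₂` to `(a·1, diag(e,-e), antidiag(q,r), s·antidiag(q,-r))`, and a further diagonal
   conjugation `diag(μ, μ⁻¹)` turns this into a COLUMN RESCALING `(c_j x⁰_j)_j` of the fixed test tuple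
   `x⁰ = (1, diag(1,-1), antidiag(1,1), antidiag(1,-1))`; so the generic locus is one orbit of
   `SL₂ × SL₂ × B₄` up to the scalings, `Q(A) = κ_A Q(x⁰)` (`exists_eval_eq_mul_eval_testTuple`), a
   semi-invariant vanishing at `x⁰` vanishes (`eq_zero_of_eval_testTuple`), and two semi-invariants of
   the same multidegree are proportional (`smul_eq_smul_of_semiInvariant`).

## References

* L. Manivel, *A note on certain Kronecker coefficients*, Proc. AMS 138 (2010) 1–7 = arXiv:0809.3710
  (the computation for `n = 2`); quoted in
* [BurgisserEtAl2011] P. Bürgisser, J. M. Landsberg, L. Manivel, J. Weyman, *An overview of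
  mathematical issues arising in the geometric complexity theory approach to VP ≠ VNP*, SIAM J. Comput.
  40 (2011), §8.3 Prop. 8.1.
* [GoodmanWallachGTM255] R. Goodman, N. R. Wallach, GTM 255, §2.3.1 (`SL₂`), §5.2.1 (polynomial
  invariants of the orthogonal group; here only the elementary `SO₄ = SL₂ × SL₂` sign-flip argument is
  used, not the FFT).
* [FultonHarrisGTM129] W. Fulton, J. Harris, GTM 129, §15.3 (weight vectors in polynomial rings).

## Tree / Mathlib

Tree: `TwoRowSl2Invariance` (`aeval_scale_of_mem`). Mathlib: `Matrix.adjugate_fin_two`,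
`Matrix.det_fin_two`, `Matrix.mul_adjugate`, `MvPolynomial.bind₁`, `MvPolynomial.eval₂Hom_bind₁`,
`MvPolynomial.funext`, `IsAlgClosed.exists_eq_mul_self`, `MvPolynomial.weightedHomogeneousSubmodule`.
-/

noncomputable section

open Matrix MvPolynomial
open scoped BigOperators

namespace Literature.RepresentationTheory.ClassicalInvariants.TwoByTwoTuple

/-! ### §0 The model: polynomials on 4-tuples of `2 × 2` matrices -/

/-- `2 × 2` matrices (abbreviation). [folklore] -/
abbrev M2 (R : Type*) : Type _ := Matrix (Fin 2) (Fin 2) R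

/-- The variables `X_{((l,i),j)}`: entry `(l,i)` of the `j`-th matrix, `j < 4` (the index convention
of the tree's `KroneckerTriplePoly.Alpha`). [folklore] -/
abbrev Idx : Type := (Fin 2 × Fin 2) × Fin 4

section Points

variable {K : Type*}

/-- The point of `K^{Idx}` given by a 4-tuple of matrices. [folklore] -/
def pt (A : Fin 4 → M2 K) : Idx → K := fun v => A v.2 v.1.1 v.1.2

/-- The 4-tuple of matrices given by a point of `K^{Idx}`. [folklore] -/
def tupleOf (x : Idx → K) : Fin 4 → M2 K := fun j => Matrix.of fun l i => x ((l, i), j)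

/-- Unfolding `pt` (plumbing). [folklore] -/
@[simp] private theorem pt_apply (A : Fin 4 → M2 K) (v : Idx) : pt A v = A v.2 v.1.1 v.1.2 := rfl

/-- `pt ∘ tupleOf = id` (plumbing). [folklore] -/
@[simp] private theorem pt_tupleOf (x : Idx → K) : pt (tupleOf x) = x := by
  funext v; simp [tupleOf]

/-- `tupleOf ∘ pt = id` (plumbing). [folklore] -/
@[simp] private theorem tupleOf_pt (A : Fin 4 → M2 K) : tupleOf (pt A) = A := by
  funext j; ext l i; simp [tupleOf]

end Points

variable {k : Type*} [Field k]

/-- Left substitution `x_j ↦ gᵀ x_j` on the variables: `X_{((l,i),j)} ↦ Σ_{l'} g_{l' l} X_{((l',i),j)}`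
(the tree's `legSubst₁` on the `2 × 2` block). [cite: FultonHarrisGTM129, §15.3] -/
def subst₁ (g : M2 k) : MvPolynomial Idx k →ₐ[k] MvPolynomial Idx k :=
  bind₁ fun v => ∑ l : Fin 2, g l v.1.1 • X ((l, v.1.2), v.2)

/-- Right substitution: `X_{((l,i),j)} ↦ Σ_{i'} g_{i' i} X_{((l,i'),j)}` (the tree's `legSubst₂`).
[cite: FultonHarrisGTM129, §15.3] -/
def subst₂ (g : M2 k) : MvPolynomial Idx k →ₐ[k] MvPolynomial Idx k :=
  bind₁ fun v => ∑ i : Fin 2, g i v.1.2 • X ((v.1.1, i), v.2)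

/-- The column shear `x_b ↦ x_b + t x_a` on the variables (`legSubst₃` of the unipotent `1 + t e_{ab}`).
[cite: GoodmanWallachGTM255, §2.3.1] -/
def shear₃ (a b : Fin 4) (t : k) : MvPolynomial Idx k →ₐ[k] MvPolynomial Idx k :=
  bind₁ fun v => if v.2 = b then X v + C t * X (v.1, a) else X v

/-- The column scaling `x_b ↦ c x_b` on the variables. [cite: FultonHarrisGTM129, §15.3] -/
def scale₃ (b : Fin 4) (c : k) : MvPolynomial Idx k →ₐ[k] MvPolynomial Idx k :=
  bind₁ fun v => if v.2 = b then C c * X v else X v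

/-- The weight "degree in the entries of the `j`-th matrix". [cite: FultonHarrisGTM129, §15.3] -/
def colWt (j : Fin 4) : Idx → ℕ := fun v => if v.2 = j then 1 else 0

/-- Evaluation of a `bind₁`-substitution (plumbing). [folklore] -/
private theorem eval_bind₁' (x : Idx → k) (h : Idx → MvPolynomial Idx k) (Q : MvPolynomial Idx k) :
    eval x (bind₁ h Q) = eval (fun i => eval x (h i)) Q :=
  eval₂Hom_bind₁ _ _ _ _

/-- `subst₁ g` evaluated at a tuple is evaluation at `(gᵀ x_j)_j`. [cite: FultonHarrisGTM129, §15.3] -/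
theorem eval_subst₁ (g : M2 k) (A : Fin 4 → M2 k) (Q : MvPolynomial Idx k) :
    eval (pt A) (subst₁ g Q) = eval (pt fun j => gᵀ * A j) Q := by
  rw [subst₁, eval_bind₁']
  congr 2
  funext v
  simp [Matrix.mul_apply, Fin.sum_univ_two, smul_eq_C_mul]

/-- `subst₂ g` evaluated at a tuple is evaluation at `(x_j g)_j`. [cite: FultonHarrisGTM129, §15.3] -/
theorem eval_subst₂ (g : M2 k) (A : Fin 4 → M2 k) (Q : MvPolynomial Idx k) :
    eval (pt A) (subst₂ g Q) = eval (pt fun j => A j * g) Q := by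
  rw [subst₂, eval_bind₁']
  congr 2
  funext v
  simp [Matrix.mul_apply, Fin.sum_univ_two, smul_eq_C_mul, mul_comm]

/-- `shear₃ a b t` evaluated at a tuple. [cite: GoodmanWallachGTM255, §2.3.1] -/
theorem eval_shear₃ (a b : Fin 4) (t : k) (A : Fin 4 → M2 k) (Q : MvPolynomial Idx k) :
    eval (pt A) (shear₃ a b t Q) = eval (pt (Function.update A b (A b + t • A a))) Q := by
  rw [shear₃, eval_bind₁']
  congr 2
  funext v
  obtain ⟨⟨l, i⟩, j⟩ := v
  by_cases h : j = b
  · subst h; simp [mul_comm]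
  · simp [h]

/-- `scale₃ b c` evaluated at a tuple. [cite: FultonHarrisGTM129, §15.3] -/
theorem eval_scale₃ (b : Fin 4) (c : k) (A : Fin 4 → M2 k) (Q : MvPolynomial Idx k) :
    eval (pt A) (scale₃ b c Q) = eval (pt (Function.update A b (c • A b))) Q := by
  rw [scale₃, eval_bind₁']
  congr 2
  funext v
  obtain ⟨⟨l, i⟩, j⟩ := v
  by_cases h : j = b
  · subst h; simp
  · simp [h]

/-- A polynomial of degree `n` in the `b`-th matrix scales by `c^n` under `x_b ↦ c x_b`.
[cite: FultonHarrisGTM129, §15.3] -/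
theorem scale₃_eq_of_mem {b : Fin 4} {n : ℕ} (c : k) {Q : MvPolynomial Idx k}
    (hQ : Q ∈ weightedHomogeneousSubmodule k (colWt b) n) : scale₃ b c Q = C (c ^ n) * Q := by
  classical
  have hs : scale₃ (k := k) b c = aeval fun v => C (c ^ colWt b v) * X v := by
    refine MvPolynomial.algHom_ext fun v => ?_
    simp only [scale₃, bind₁_X_right, aeval_X, colWt]
    split_ifs <;> simp
  rw [hs]
  exact TwoRowSl2.aeval_scale_of_mem c hQ

/-! ### §1 Pointwise consequences of the four invariance hypotheses -/

section Pointwise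

variable {Q : MvPolynomial Idx k} {ρ : Fin 4 → ℕ}

/-- Left `SL₂`-invariance, pointwise. [cite: GoodmanWallachGTM255, §2.3.1] -/
theorem eval_left (h1 : ∀ g : M2 k, g.det = 1 → subst₁ g Q = Q) {g : M2 k} (hg : g.det = 1)
    (A : Fin 4 → M2 k) : eval (pt fun j => g * A j) Q = eval (pt A) Q := by
  have := congrArg (eval (pt A)) (h1 gᵀ (by rw [det_transpose, hg]))
  rwa [eval_subst₁, transpose_transpose] at this

/-- Right `SL₂`-invariance, pointwise. [cite: GoodmanWallachGTM255, §2.3.1] -/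
theorem eval_right (h2 : ∀ g : M2 k, g.det = 1 → subst₂ g Q = Q) {g : M2 k} (hg : g.det = 1)
    (A : Fin 4 → M2 k) : eval (pt fun j => A j * g) Q = eval (pt A) Q := by
  have := congrArg (eval (pt A)) (h2 g hg)
  rwa [eval_subst₂] at this

/-- Column-shear invariance, pointwise. [cite: GoodmanWallachGTM255, §2.3.1] -/
theorem eval_update_add (h3 : ∀ a b : Fin 4, a < b → ∀ t : k, shear₃ a b t Q = Q) {a b : Fin 4}
    (hab : a < b) (t : k) (A : Fin 4 → M2 k) :
    eval (pt (Function.update A b (A b + t • A a))) Q = eval (pt A) Q := by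
  have := congrArg (eval (pt A)) (h3 a b hab t)
  rwa [eval_shear₃] at this

/-- Multihomogeneity, pointwise. [cite: FultonHarrisGTM129, §15.3] -/
theorem eval_update_smul (h4 : ∀ j, Q ∈ weightedHomogeneousSubmodule k (colWt j) (ρ j))
    (b : Fin 4) (c : k) (A : Fin 4 → M2 k) :
    eval (pt (Function.update A b (c • A b))) Q = c ^ ρ b * eval (pt A) Q := by
  have := congrArg (eval (pt A)) (scale₃_eq_of_mem c (h4 b))
  rwa [eval_scale₃, map_mul, eval_C] at this

/-- Column shears by a sum `x_b ↦ x_b + Σ_{a ∈ S} t_a x_a` (`a < b`), pointwise.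
[cite: GoodmanWallachGTM255, §2.3.1] -/
theorem eval_update_add_sum (h3 : ∀ a b : Fin 4, a < b → ∀ t : k, shear₃ a b t Q = Q) {b : Fin 4}
    (S : Finset (Fin 4)) (hS : ∀ a ∈ S, a < b) (t : Fin 4 → k) (A : Fin 4 → M2 k) :
    eval (pt (Function.update A b (A b + ∑ a ∈ S, t a • A a))) Q = eval (pt A) Q := by
  classical
  induction S using Finset.induction_on with
  | empty => simp
  | insert a S haS ih =>
    have hab : a < b := hS a (Finset.mem_insert_self a S)
    have hS' : ∀ a' ∈ S, a' < b := fun a' ha' => hS a' (Finset.mem_insert_of_mem ha')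
    rw [Finset.sum_insert haS]
    -- one more shear on top of the tuple already sheared by `S`
    set A' : Fin 4 → M2 k := Function.update A b (A b + ∑ a ∈ S, t a • A a) with hA'
    have hstep := eval_update_add h3 hab (t a) A'
    have hA'a : A' a = A a := by
      rw [hA', Function.update_of_ne (ne_of_lt hab)]
    have hA'b : A' b = A b + ∑ a ∈ S, t a • A a := by rw [hA', Function.update_self]
    rw [hA'a, hA'b, hA', Function.update_idem] at hstep
    rw [← ih hS', ← hstep]
    congr 3
    abel

/-- A Gram–Schmidt step `x_b ↦ c (x_b + Σ_{a<b} t_a x_a)` changes `Q` by the factor `c^{π_b}`.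
[cite: GoodmanWallachGTM255, §2.3.1] -/
theorem eval_update_step (h3 : ∀ a b : Fin 4, a < b → ∀ t : k, shear₃ a b t Q = Q)
    (h4 : ∀ j, Q ∈ weightedHomogeneousSubmodule k (colWt j) (ρ j)) {b : Fin 4}
    (S : Finset (Fin 4)) (hS : ∀ a ∈ S, a < b) (t : Fin 4 → k) (c : k) (A : Fin 4 → M2 k) :
    eval (pt (Function.update A b (c • (A b + ∑ a ∈ S, t a • A a)))) Q = c ^ ρ b * eval (pt A) Q := by
  have h := eval_update_smul h4 b c (Function.update A b (A b + ∑ a ∈ S, t a • A a))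
  rw [Function.update_self, Function.update_idem, eval_update_add_sum h3 S hS t A] at h
  exact h

/-- Scaling all four matrices: `Q(c_j x_j) = (Π_j c_j^{π_j}) Q(x)`. [cite: FultonHarrisGTM129, §15.3] -/
theorem eval_smul_all (h4 : ∀ j, Q ∈ weightedHomogeneousSubmodule k (colWt j) (ρ j))
    (c : Fin 4 → k) (A : Fin 4 → M2 k) :
    eval (pt fun j => c j • A j) Q = (c 0 ^ ρ 0 * c 1 ^ ρ 1 * c 2 ^ ρ 2 * c 3 ^ ρ 3) * eval (pt A) Q := by
  have hupd : (fun j => c j • A j) =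
      Function.update (Function.update (Function.update (Function.update A 0 (c 0 • A 0)) 1
        (c 1 • Function.update A 0 (c 0 • A 0) 1)) 2
        (c 2 • Function.update (Function.update A 0 (c 0 • A 0)) 1
          (c 1 • Function.update A 0 (c 0 • A 0) 1) 2)) 3
        (c 3 • Function.update (Function.update (Function.update A 0 (c 0 • A 0)) 1
          (c 1 • Function.update A 0 (c 0 • A 0) 1)) 2
          (c 2 • Function.update (Function.update A 0 (c 0 • A 0)) 1
            (c 1 • Function.update A 0 (c 0 • A 0) 1) 2) 3) := by
    funext j
    fin_cases j <;> simp
  rw [hupd, eval_update_smul h4, eval_update_smul h4, eval_update_smul h4, eval_update_smul h4]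
  ring

end Pointwise

/-! ### §2 The polarised determinant and the `2 × 2` identities -/

section Form

variable {R : Type*} [CommRing R]

/-- The polarised determinant `B(y, z) = det(y+z) - det y - det z = tr(adj(y) z)` of `2 × 2` matrices,
the invariant symmetric form of `SO₄ ≅ SL₂ × SL₂ / ±1`. [cite: GoodmanWallachGTM255, §2.3.1] -/
def B (y z : M2 R) : R := y 0 0 * z 1 1 + y 1 1 * z 0 0 - y 0 1 * z 1 0 - y 1 0 * z 0 1

/-- `B(y, z) = tr(adj(y) z)`. [cite: GoodmanWallachGTM255, §2.3.1] -/
theorem B_eq_trace (y z : M2 R) : B y z = Matrix.trace (adjugate y * z) := by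
  rw [adjugate_fin_two, Matrix.trace_fin_two]
  simp [Matrix.mul_apply, Fin.sum_univ_two, B]
  ring

/-- `B(y, y) = 2 det y`. [cite: GoodmanWallachGTM255, §2.3.1] -/
theorem B_self (y : M2 R) : B y y = 2 * y.det := by
  rw [det_fin_two, B]; ring

/-- An anisotropic matrix is invertible: `B(y,y) ≠ 0 → det y ≠ 0`. [cite: GoodmanWallachGTM255, §2.3.1] -/
theorem det_ne_zero_of_B {y : M2 R} (h : B y y ≠ 0) : y.det ≠ 0 := by
  rw [B_self] at h; exact right_ne_zero_of_mul h

/-- `B` is symmetric. [cite: GoodmanWallachGTM255, §2.3.1] -/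
theorem B_comm (y z : M2 R) : B y z = B z y := by simp only [B]; ring

/-- `B` is additive (right). [cite: GoodmanWallachGTM255, §2.3.1] -/
theorem B_add_right (y z z' : M2 R) : B y (z + z') = B y z + B y z' := by
  simp only [B, Matrix.add_apply]; ring

/-- `B` is homogeneous (right). [cite: GoodmanWallachGTM255, §2.3.1] -/
theorem B_smul_right (c : R) (y z : M2 R) : B y (c • z) = c * B y z := by
  simp only [B, Matrix.smul_apply, smul_eq_mul]; ring

/-- `B` is subtractive (right). [cite: GoodmanWallachGTM255, §2.3.1] -/
theorem B_sub_right (y z z' : M2 R) : B y (z - z') = B y z - B y z' := by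
  simp only [B, Matrix.sub_apply]; ring

/-- `B` and negation (right). [cite: GoodmanWallachGTM255, §2.3.1] -/
theorem B_neg_right (y z : M2 R) : B y (-z) = -B y z := by
  simp only [B, Matrix.neg_apply]; ring

/-- `B` is homogeneous (left). [cite: GoodmanWallachGTM255, §2.3.1] -/
theorem B_smul_left (c : R) (y z : M2 R) : B (c • y) z = c * B y z := by
  rw [B_comm, B_smul_right, B_comm]

/-- Invariance: `B(P y R, P z R) = det P · det R · B(y, z)`. [cite: GoodmanWallachGTM255, §2.3.1] -/
theorem B_mul_mul (P y z S : M2 R) : B (P * y * S) (P * z * S) = P.det * S.det * B y z := by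
  simp only [B, Matrix.mul_apply, Fin.sum_univ_two, det_fin_two]
  ring

/-- `B` commutes with ring homomorphisms (plumbing). [folklore] -/
private theorem map_B {S : Type*} [CommRing S] (φ : R →+* S) (y z : M2 R) :
    φ (B y z) = B (φ.mapMatrix y) (φ.mapMatrix z) := by
  simp [B]

/-- **The flip identity.** `z_c adj(z₀) z adj(z_c) z₀ + det z₀ det z_c · z` lies in the ideal generated
by `B(z₀, z_c)`, `B(z₀, z)`, `B(z_c, z)`, with the displayed explicit coefficients — so for `z` orthogonal
to the orthogonal pair `z₀, z_c` the map `z ↦ z_c adj(z₀) z adj(z_c) z₀` is `-det z₀ det z_c` times the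
identity (a reflection-pair of `SO₄` written in `SL₂ × SL₂`). [cite: GoodmanWallachGTM255, §2.3.1] -/
theorem flip_identity (a c z : M2 R) :
    c * adjugate a * z * adjugate c * a + (a.det * c.det) • z =
      B a c • (c * adjugate a * z) - B a z • (c * adjugate a * c) + (a.det * B c z) • c := by
  ext i j
  rw [adjugate_fin_two, adjugate_fin_two]
  fin_cases i <;> fin_cases j <;>
    simp [det_fin_two, B, Matrix.mul_apply, Fin.sum_univ_two, Matrix.add_apply, Matrix.sub_apply] <;>
    ring

/-- The flip fixes `z₀`. [cite: GoodmanWallachGTM255, §2.3.1] -/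
theorem flip_fix₀ (a c : M2 R) : c * adjugate a * a * adjugate c * a = (a.det * c.det) • a := by
  rw [Matrix.mul_assoc c, adjugate_mul, Matrix.mul_smul, Matrix.mul_one, Matrix.smul_mul,
    Matrix.smul_mul, mul_adjugate, Matrix.smul_mul, Matrix.one_mul, smul_smul, mul_comm]

/-- The flip fixes `z_c`. [cite: GoodmanWallachGTM255, §2.3.1] -/
theorem flip_fix₁ (a c : M2 R) : c * adjugate a * c * adjugate c * a = (a.det * c.det) • c := by
  rw [Matrix.mul_assoc (c * adjugate a), mul_adjugate, Matrix.mul_smul, Matrix.mul_one,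
    Matrix.smul_mul, Matrix.mul_assoc c, adjugate_mul, Matrix.mul_smul, Matrix.mul_one, smul_smul,
    mul_comm]

end Form

/-! ### §3 Denominator-free Gram–Schmidt -/

section GramSchmidt

variable {R : Type*} [CommRing R]

/-- Gram–Schmidt, second vector: `z₁ = B(z₀,z₀) x₁ - B(z₀,x₁) z₀`. [cite: GoodmanWallachGTM255, §2.3.1] -/
def gs₁ (A : Fin 4 → M2 R) : M2 R := B (A 0) (A 0) • A 1 - B (A 0) (A 1) • A 0

/-- Gram–Schmidt, third vector (denominator-free). [cite: GoodmanWallachGTM255, §2.3.1] -/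
def gs₂ (A : Fin 4 → M2 R) : M2 R :=
  (B (A 0) (A 0) * B (gs₁ A) (gs₁ A)) • A 2 - (B (gs₁ A) (gs₁ A) * B (A 0) (A 2)) • A 0 -
    (B (A 0) (A 0) * B (gs₁ A) (A 2)) • gs₁ A

/-- Gram–Schmidt, fourth vector (denominator-free). [cite: GoodmanWallachGTM255, §2.3.1] -/
def gs₃ (A : Fin 4 → M2 R) : M2 R :=
  (B (A 0) (A 0) * B (gs₁ A) (gs₁ A) * B (gs₂ A) (gs₂ A)) • A 3 -
    (B (gs₁ A) (gs₁ A) * B (gs₂ A) (gs₂ A) * B (A 0) (A 3)) • A 0 -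
    (B (A 0) (A 0) * B (gs₂ A) (gs₂ A) * B (gs₁ A) (A 3)) • gs₁ A -
    (B (A 0) (A 0) * B (gs₁ A) (gs₁ A) * B (gs₂ A) (A 3)) • gs₂ A

/-- The Gram–Schmidt tuple `(x₀, z₁, z₂, z₃)`. [cite: GoodmanWallachGTM255, §2.3.1] -/
def gs (A : Fin 4 → M2 R) : Fin 4 → M2 R :=
  Function.update (Function.update (Function.update A 1 (gs₁ A)) 2 (gs₂ A)) 3 (gs₃ A)

/-- Component `0` of the Gram–Schmidt tuple (plumbing). [folklore] -/
@[simp] private theorem gs_zero (A : Fin 4 → M2 R) : gs A 0 = A 0 := by simp [gs]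
/-- Component `1` of the Gram–Schmidt tuple (plumbing). [folklore] -/
@[simp] private theorem gs_one (A : Fin 4 → M2 R) : gs A 1 = gs₁ A := by simp [gs]
/-- Component `2` of the Gram–Schmidt tuple (plumbing). [folklore] -/
@[simp] private theorem gs_two (A : Fin 4 → M2 R) : gs A 2 = gs₂ A := by simp [gs]
/-- Component `3` of the Gram–Schmidt tuple (plumbing). [folklore] -/
@[simp] private theorem gs_three (A : Fin 4 → M2 R) : gs A 3 = gs₃ A := by simp [gs]

/-- Orthogonality `B(z₀, z₁) = 0`. [cite: GoodmanWallachGTM255, §2.3.1] -/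
theorem B_gs01 (A : Fin 4 → M2 R) : B (A 0) (gs₁ A) = 0 := by
  simp only [gs₁, B_sub_right, B_smul_right]; ring

/-- Orthogonality `B(z₀, z₂) = 0`. [cite: GoodmanWallachGTM255, §2.3.1] -/
theorem B_gs02 (A : Fin 4 → M2 R) : B (A 0) (gs₂ A) = 0 := by
  have h := B_gs01 A
  simp only [gs₂, B_sub_right, B_smul_right]
  rw [h]; ring

/-- Orthogonality `B(z₁, z₂) = 0`. [cite: GoodmanWallachGTM255, §2.3.1] -/
theorem B_gs12 (A : Fin 4 → M2 R) : B (gs₁ A) (gs₂ A) = 0 := by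
  have h := B_gs01 A
  rw [B_comm] at h
  simp only [gs₂, B_sub_right, B_smul_right]
  rw [h]; ring

/-- Orthogonality `B(z₀, z₃) = 0`. [cite: GoodmanWallachGTM255, §2.3.1] -/
theorem B_gs03 (A : Fin 4 → M2 R) : B (A 0) (gs₃ A) = 0 := by
  have h1 := B_gs01 A
  have h2 := B_gs02 A
  simp only [gs₃, B_sub_right, B_smul_right]
  rw [h1, h2]; ring

/-- Orthogonality `B(z₁, z₃) = 0`. [cite: GoodmanWallachGTM255, §2.3.1] -/
theorem B_gs13 (A : Fin 4 → M2 R) : B (gs₁ A) (gs₃ A) = 0 := by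
  have h1 := B_gs01 A
  have h2 := B_gs12 A
  rw [B_comm] at h1
  simp only [gs₃, B_sub_right, B_smul_right]
  rw [h1, h2]; ring

/-- Orthogonality `B(z₂, z₃) = 0`. [cite: GoodmanWallachGTM255, §2.3.1] -/
theorem B_gs23 (A : Fin 4 → M2 R) : B (gs₂ A) (gs₃ A) = 0 := by
  have h1 := B_gs02 A
  have h2 := B_gs12 A
  rw [B_comm] at h1 h2
  simp only [gs₃, B_sub_right, B_smul_right]
  rw [h1, h2]; ring

/-- All orthogonality relations of the Gram–Schmidt tuple. [cite: GoodmanWallachGTM255, §2.3.1] -/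
theorem B_gs_eq_zero (A : Fin 4 → M2 R) {i j : Fin 4} (hij : i ≠ j) : B (gs A i) (gs A j) = 0 := by
  have h01 := B_gs01 A
  have h02 := B_gs02 A
  have h03 := B_gs03 A
  have h12 := B_gs12 A
  have h13 := B_gs13 A
  have h23 := B_gs23 A
  have h10 : B (gs₁ A) (A 0) = 0 := by rw [B_comm]; exact h01
  have h20 : B (gs₂ A) (A 0) = 0 := by rw [B_comm]; exact h02
  have h30 : B (gs₃ A) (A 0) = 0 := by rw [B_comm]; exact h03
  have h21 : B (gs₂ A) (gs₁ A) = 0 := by rw [B_comm]; exact h12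
  have h31 : B (gs₃ A) (gs₁ A) = 0 := by rw [B_comm]; exact h13
  have h32 : B (gs₃ A) (gs₂ A) = 0 := by rw [B_comm]; exact h23
  fin_cases i <;> fin_cases j
  · exact absurd rfl hij
  · simpa using h01
  · simpa using h02
  · simpa using h03
  · simpa using h10
  · exact absurd rfl hij
  · simpa using h12
  · simpa using h13
  · simpa using h20
  · simpa using h21
  · exact absurd rfl hij
  · simpa using h23
  · simpa using h30
  · simpa using h31
  · simpa using h32
  · exact absurd rfl hij

/-- Gram–Schmidt commutes with ring homomorphisms (plumbing, for the density polynomial). [folklore] -/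
private theorem map_gs {S : Type*} [CommRing S] (φ : R →+* S) (A : Fin 4 → M2 R) (j : Fin 4) :
    φ.mapMatrix (gs A j) = gs (fun j => φ.mapMatrix (A j)) j := by
  have h1 : φ.mapMatrix (gs₁ A) = gs₁ (fun j => φ.mapMatrix (A j)) := by
    ext l i; simp [gs₁, map_B]
  have h1' : ∀ l i, φ (gs₁ A l i) = gs₁ (fun j => φ.mapMatrix (A j)) l i := fun l i => by
    simpa using congrFun (congrFun h1 l) i
  have h2 : φ.mapMatrix (gs₂ A) = gs₂ (fun j => φ.mapMatrix (A j)) := by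
    ext l i; simp [gs₂, map_B, h1, h1']
  have h2' : ∀ l i, φ (gs₂ A l i) = gs₂ (fun j => φ.mapMatrix (A j)) l i := fun l i => by
    simpa using congrFun (congrFun h2 l) i
  have h3 : φ.mapMatrix (gs₃ A) = gs₃ (fun j => φ.mapMatrix (A j)) := by
    ext l i; simp [gs₃, map_B, h1, h2, h1', h2']
  fin_cases j
  · simp
  · simpa using h1
  · simpa using h2
  · simpa using h3

end GramSchmidt

/-! ### §4 Gram–Schmidt and flips against the invariance hypotheses -/

section Flip

variable {Q : MvPolynomial Idx k} {ρ : Fin 4 → ℕ}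

/-- The value of `Q` on the Gram–Schmidt tuple is a nonzero multiple of its value on the tuple.
[cite: GoodmanWallachGTM255, §2.3.1] -/
theorem eval_gs (h3 : ∀ a b : Fin 4, a < b → ∀ t : k, shear₃ a b t Q = Q)
    (h4 : ∀ j, Q ∈ weightedHomogeneousSubmodule k (colWt j) (ρ j)) (A : Fin 4 → M2 k)
    (h0 : B (A 0) (A 0) ≠ 0) (h1 : B (gs₁ A) (gs₁ A) ≠ 0) (h2 : B (gs₂ A) (gs₂ A) ≠ 0) :
    eval (pt (gs A)) Q =
      (B (A 0) (A 0) * B (gs₁ A) (gs₁ A) * B (gs₂ A) (gs₂ A)) ^ ρ 3 *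
        ((B (A 0) (A 0) * B (gs₁ A) (gs₁ A)) ^ ρ 2 * (B (A 0) (A 0) ^ ρ 1 * eval (pt A) Q)) := by
  classical
  set b00 := B (A 0) (A 0)
  set b11 := B (gs₁ A) (gs₁ A)
  set b22 := B (gs₂ A) (gs₂ A)
  -- stage 1
  set A1 : Fin 4 → M2 k := Function.update A 1 (gs₁ A) with hA1
  have e1 : eval (pt A1) Q = b00 ^ ρ 1 * eval (pt A) Q := by
    have h := eval_update_step (ρ := ρ) h3 h4 (b := 1) {0} (by decide)
      (fun _ => -(B (A 0) (A 1) / b00)) b00 A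
    have : b00 • (A 1 + ∑ a ∈ ({0} : Finset (Fin 4)), (-(B (A 0) (A 1) / b00)) • A a) = gs₁ A := by
      rw [Finset.sum_singleton, gs₁, smul_add, smul_smul, mul_neg, mul_div_cancel₀ _ h0, neg_smul,
        sub_eq_add_neg]
    rwa [this] at h
  -- stage 2
  set A2 : Fin 4 → M2 k := Function.update A1 2 (gs₂ A) with hA2
  have hA1_0 : A1 0 = A 0 := by rw [hA1, Function.update_of_ne (by decide)]
  have hA1_1 : A1 1 = gs₁ A := by rw [hA1, Function.update_self]
  have hA1_2 : A1 2 = A 2 := by rw [hA1, Function.update_of_ne (by decide)]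
  have e2 : eval (pt A2) Q = (b00 * b11) ^ ρ 2 * eval (pt A1) Q := by
    let t : Fin 4 → k := fun a => if a = 0 then -(B (A 0) (A 2) / b00) else -(B (gs₁ A) (A 2) / b11)
    have h := eval_update_step (ρ := ρ) h3 h4 (b := 2) {0, 1} (by decide) t (b00 * b11) A1
    have : (b00 * b11) • (A1 2 + ∑ a ∈ ({0, 1} : Finset (Fin 4)), t a • A1 a) = gs₂ A := by
      rw [Finset.sum_pair (by decide), hA1_0, hA1_1, hA1_2, gs₂]
      simp only [t, if_true, show (1 : Fin 4) ≠ 0 by decide, if_false, smul_add, smul_smul]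
      rw [show b00 * b11 * -(B (A 0) (A 2) / b00) = -(b11 * B (A 0) (A 2)) by
            field_simp,
        show b00 * b11 * -(B (gs₁ A) (A 2) / b11) = -(b00 * B (gs₁ A) (A 2)) by
            field_simp]
      rw [neg_smul, neg_smul]
      abel
    rwa [this] at h
  -- stage 3
  have hA2_0 : A2 0 = A 0 := by rw [hA2, Function.update_of_ne (by decide), hA1_0]
  have hA2_1 : A2 1 = gs₁ A := by rw [hA2, Function.update_of_ne (by decide), hA1_1]
  have hA2_2 : A2 2 = gs₂ A := by rw [hA2, Function.update_self]
  have hA2_3 : A2 3 = A 3 := by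
    rw [hA2, Function.update_of_ne (by decide), hA1, Function.update_of_ne (by decide)]
  have e3 : eval (pt (gs A)) Q = (b00 * b11 * b22) ^ ρ 3 * eval (pt A2) Q := by
    let t : Fin 4 → k := fun a => if a = 0 then -(B (A 0) (A 3) / b00) else
      if a = 1 then -(B (gs₁ A) (A 3) / b11) else -(B (gs₂ A) (A 3) / b22)
    have h := eval_update_step (ρ := ρ) h3 h4 (b := 3) {0, 1, 2} (by decide) t (b00 * b11 * b22) A2
    have hgs : gs A = Function.update A2 3 (gs₃ A) := by rw [gs, hA2, hA1]
    have : (b00 * b11 * b22) • (A2 3 + ∑ a ∈ ({0, 1, 2} : Finset (Fin 4)), t a • A2 a) = gs₃ A := by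
      rw [Finset.sum_insert (by decide), Finset.sum_pair (by decide), hA2_0, hA2_1, hA2_2, hA2_3, gs₃]
      simp only [t, if_true, show (1 : Fin 4) ≠ 0 by decide, show (2 : Fin 4) ≠ 0 by decide,
        show (2 : Fin 4) ≠ 1 by decide, if_false, smul_add, smul_smul]
      rw [show b00 * b11 * b22 * -(B (A 0) (A 3) / b00) = -(b11 * b22 * B (A 0) (A 3)) by
            field_simp,
        show b00 * b11 * b22 * -(B (gs₁ A) (A 3) / b11) = -(b00 * b22 * B (gs₁ A) (A 3)) by
            field_simp,
        show b00 * b11 * b22 * -(B (gs₂ A) (A 3) / b22) = -(b00 * b11 * B (gs₂ A) (A 3)) by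
            field_simp]
      rw [neg_smul, neg_smul, neg_smul]
      abel
    rw [hgs, ← this]
    exact h
  rw [e3, e2, e1]

variable [IsAlgClosed k]

/-- **The sign flip.** For a tuple `T` with `z₀ = T 0`, `z_c = T c` anisotropic and `B`-orthogonal to
everything else, negating all `T j`, `j ∉ {0, c}`, does not change the value of an
`SL₂ × SL₂`-invariant `Q`. [cite: GoodmanWallachGTM255, §2.3.1] -/
theorem eval_flip (h1 : ∀ g : M2 k, g.det = 1 → subst₁ g Q = Q)
    (h2 : ∀ g : M2 k, g.det = 1 → subst₂ g Q = Q) (T : Fin 4 → M2 k) {c : Fin 4} (hc : c ≠ 0)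
    (hdet : (T 0).det * (T c).det ≠ 0)
    (horth : ∀ j, j ≠ 0 → j ≠ c → B (T 0) (T j) = 0 ∧ B (T c) (T j) = 0) (h0c : B (T 0) (T c) = 0) :
    eval (pt fun j => if j = 0 ∨ j = c then T j else -T j) Q = eval (pt T) Q := by
  obtain ⟨γ, hγ⟩ := IsAlgClosed.exists_eq_mul_self ((T 0).det * (T c).det)
  have hγ0 : γ ≠ 0 := by rintro rfl; exact hdet (by rw [hγ, mul_zero])
  set P : M2 k := γ⁻¹ • (T c * adjugate (T 0)) with hP
  set Rm : M2 k := γ⁻¹ • (adjugate (T c) * T 0) with hR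
  have hγ2 : γ⁻¹ ^ 2 * (γ * γ) = 1 := by field_simp
  have hdP : P.det = 1 := by
    rw [hP, det_smul, det_mul, det_adjugate, Fintype.card_fin]
    rw [show γ⁻¹ ^ 2 * ((T c).det * (T 0).det ^ (2 - 1)) = γ⁻¹ ^ 2 * ((T 0).det * (T c).det) by ring,
      hγ, hγ2]
  have hdR : Rm.det = 1 := by
    rw [hR, det_smul, det_mul, det_adjugate, Fintype.card_fin]
    rw [show γ⁻¹ ^ 2 * ((T c).det ^ (2 - 1) * (T 0).det) = γ⁻¹ ^ 2 * ((T 0).det * (T c).det) by ring,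
      hγ, hγ2]
  have key : (fun j => P * T j * Rm) = fun j => if j = 0 ∨ j = c then T j else -T j := by
    funext j
    have hPTR : P * T j * Rm = (γ⁻¹ * γ⁻¹) • (T c * adjugate (T 0) * T j * adjugate (T c) * T 0) := by
      rw [hP, hR, Matrix.smul_mul, Matrix.smul_mul, Matrix.mul_smul, smul_smul]
      simp only [Matrix.mul_assoc]
    have hγγ : γ⁻¹ * γ⁻¹ * ((T 0).det * (T c).det) = 1 := by
      rw [hγ]; field_simp
    rw [hPTR]
    by_cases hj0 : j = 0
    · subst hj0
      rw [if_pos (Or.inl rfl), flip_fix₀, smul_smul, hγγ, one_smul]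
    by_cases hjc : j = c
    · subst hjc
      rw [if_pos (Or.inr rfl), flip_fix₁, smul_smul, hγγ, one_smul]
    · rw [if_neg (not_or.2 ⟨hj0, hjc⟩)]
      have hfl := flip_identity (T 0) (T c) (T j)
      rw [h0c, (horth j hj0 hjc).1, (horth j hj0 hjc).2, zero_smul, zero_smul, mul_zero, zero_smul,
        sub_zero, add_zero, ← eq_neg_iff_add_eq_zero] at hfl
      rw [hfl, smul_neg, smul_smul, hγγ, one_smul]
  rw [← key]
  have e1 := eval_left h1 hdP (fun j => T j * Rm)
  have e2 := eval_right h2 hdR T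
  simp only [← Matrix.mul_assoc] at e1
  rw [e1, e2]

end Flip

/-! ### §5 Genericity is Zariski-dense: the discriminant polynomial -/

section Density

/-- The generic tuple: the four matrices of variables. [folklore] -/
def Xtuple : Fin 4 → M2 (MvPolynomial Idx k) := fun j => Matrix.of fun l i => X ((l, i), j)

/-- The genericity polynomial: the product of the `B`-squares of the Gram–Schmidt vectors of the
generic tuple. [cite: GoodmanWallachGTM255, §2.3.1] -/
def discr : MvPolynomial Idx k := ∏ j : Fin 4, B (gs (Xtuple (k := k)) j) (gs Xtuple j)

/-- Evaluating the generic tuple gives the tuple of the point (plumbing). [folklore] -/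
private theorem eval_mapMatrix_Xtuple (x : Idx → k) (j : Fin 4) :
    (eval x).mapMatrix (Xtuple j) = tupleOf x j := by
  ext l i; simp [Xtuple, tupleOf]

/-- The genericity polynomial evaluates to the product of the `B`-squares of the Gram–Schmidt vectors.
[cite: GoodmanWallachGTM255, §2.3.1] -/
theorem eval_discr (x : Idx → k) :
    eval x discr = ∏ j : Fin 4, B (gs (tupleOf x) j) (gs (tupleOf x) j) := by
  rw [discr, map_prod]
  refine Finset.prod_congr rfl fun j _ => ?_
  rw [map_B, map_gs]
  congr 2 <;> funext j' <;> exact eval_mapMatrix_Xtuple x j'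

/-- A `B`-orthogonal anisotropic test tuple: `(1, diag(1,-1), antidiag(1,1), antidiag(1,-1))`.
[cite: GoodmanWallachGTM255, §2.3.1] -/
def testTuple : Fin 4 → M2 k := ![1, !![1, 0; 0, -1], !![0, 1; 1, 0], !![0, 1; -1, 0]]

/-- The genericity polynomial does not vanish at the test tuple (characteristic `0`).
[cite: GoodmanWallachGTM255, §2.3.1] -/
theorem eval_discr_testTuple_ne_zero [CharZero k] : eval (pt (testTuple (k := k))) discr ≠ 0 := by
  rw [eval_discr, tupleOf_pt]
  have hT0 : testTuple (k := k) 0 = 1 := rfl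
  have hT1 : testTuple (k := k) 1 = !![1, 0; 0, -1] := rfl
  have hT2 : testTuple (k := k) 2 = !![0, 1; 1, 0] := rfl
  have hT3 : testTuple (k := k) 3 = !![0, 1; -1, 0] := rfl
  have b00 : B (testTuple (k := k) 0) (testTuple 0) = 2 := by rw [hT0]; simp [B]; norm_num
  have b01 : B (testTuple (k := k) 0) (testTuple 1) = 0 := by rw [hT0, hT1]; simp [B]
  have b02 : B (testTuple (k := k) 0) (testTuple 2) = 0 := by rw [hT0, hT2]; simp [B]
  have b03 : B (testTuple (k := k) 0) (testTuple 3) = 0 := by rw [hT0, hT3]; simp [B]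
  have b11 : B (testTuple (k := k) 1) (testTuple 1) = -2 := by rw [hT1]; simp [B]; norm_num
  have b12 : B (testTuple (k := k) 1) (testTuple 2) = 0 := by rw [hT1, hT2]; simp [B]
  have b13 : B (testTuple (k := k) 1) (testTuple 3) = 0 := by rw [hT1, hT3]; simp [B]
  have b22 : B (testTuple (k := k) 2) (testTuple 2) = -2 := by rw [hT2]; simp [B]; norm_num
  have b23 : B (testTuple (k := k) 2) (testTuple 3) = 0 := by rw [hT2, hT3]; simp [B]
  have b33 : B (testTuple (k := k) 3) (testTuple 3) = 2 := by rw [hT3]; simp [B]; norm_num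
  have g1 : gs₁ (testTuple (k := k)) = (2 : k) • testTuple 1 := by
    rw [gs₁, b00, b01, zero_smul, sub_zero]
  have c11 : B (gs₁ (testTuple (k := k))) (gs₁ testTuple) = -8 := by
    rw [g1, B_smul_left, B_smul_right, b11]; norm_num
  have c12 : B (gs₁ (testTuple (k := k))) (testTuple 2) = 0 := by rw [g1, B_smul_left, b12, mul_zero]
  have c13 : B (gs₁ (testTuple (k := k))) (testTuple 3) = 0 := by rw [g1, B_smul_left, b13, mul_zero]
  have g2 : gs₂ (testTuple (k := k)) = (-16 : k) • testTuple 2 := by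
    rw [gs₂, b00, c11, b02, c12, mul_zero, mul_zero, zero_smul, zero_smul, sub_zero, sub_zero]
    norm_num
  have c22 : B (gs₂ (testTuple (k := k))) (gs₂ testTuple) = -512 := by
    rw [g2, B_smul_left, B_smul_right, b22]; norm_num
  have c23 : B (gs₂ (testTuple (k := k))) (testTuple 3) = 0 := by rw [g2, B_smul_left, b23, mul_zero]
  have g3 : gs₃ (testTuple (k := k)) = (8192 : k) • testTuple 3 := by
    rw [gs₃, b00, c11, c22, b03, c13, c23, mul_zero, mul_zero, mul_zero, zero_smul, zero_smul,
      zero_smul, sub_zero, sub_zero, sub_zero]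
    norm_num
  have c33 : B (gs₃ (testTuple (k := k))) (gs₃ testTuple) = 134217728 := by
    rw [g3, B_smul_left, B_smul_right, b33]; norm_num
  rw [Fin.prod_univ_four, gs_zero, gs_one, gs_two, gs_three, b00, c11, c22, c33]
  norm_num

/-- The genericity polynomial is nonzero (characteristic `0`). [cite: GoodmanWallachGTM255, §2.3.1] -/
theorem discr_ne_zero [CharZero k] : (discr : MvPolynomial Idx k) ≠ 0 := fun h =>
  eval_discr_testTuple_ne_zero (k := k) (by rw [h, map_zero])

/-- **Density.** A polynomial vanishing at every tuple whose Gram–Schmidt vectors are all anisotropic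
is zero (`k` of characteristic `0`, hence infinite). [cite: GoodmanWallachGTM255, §2.3.1] -/
theorem eq_zero_of_forall_generic [CharZero k] {Q : MvPolynomial Idx k}
    (hQ : ∀ A : Fin 4 → M2 k, (∀ j, B (gs A j) (gs A j) ≠ 0) → eval (pt A) Q = 0) : Q = 0 := by
  have hQD : Q * discr = 0 := by
    refine MvPolynomial.funext fun x => ?_
    rw [map_mul, map_zero]
    by_cases hD : eval x discr = 0
    · rw [hD, mul_zero]
    · have hall : ∀ j, B (gs (tupleOf x) j) (gs (tupleOf x) j) ≠ 0 := by
        intro j hj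
        apply hD
        rw [eval_discr]
        exact Finset.prod_eq_zero (Finset.mem_univ j) hj
      have := hQ (tupleOf x) hall
      rw [pt_tupleOf] at this
      rw [this, zero_mul]
  exact (mul_eq_zero.1 hQD).resolve_right discr_ne_zero

end Density

/-! ### §6 Theorem A: parity -/

section Parity

variable [CharZero k] [IsAlgClosed k] {Q : MvPolynomial Idx k} {ρ : Fin 4 → ℕ}

/-- The flip against multihomogeneity: if `π_a + π_b` is odd for the two flipped positions then `Q`
vanishes at every generic tuple, hence `Q = 0`. [cite: GoodmanWallachGTM255, §2.3.1] -/
theorem eq_zero_of_odd_pair (h1 : ∀ g : M2 k, g.det = 1 → subst₁ g Q = Q)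
    (h2 : ∀ g : M2 k, g.det = 1 → subst₂ g Q = Q)
    (h3 : ∀ a b : Fin 4, a < b → ∀ t : k, shear₃ a b t Q = Q)
    (h4 : ∀ j, Q ∈ weightedHomogeneousSubmodule k (colWt j) (ρ j))
    {a b c : Fin 4} (hc : c ≠ 0) (ha : a ≠ 0) (hb : b ≠ 0) (hac : a ≠ c) (hbc : b ≠ c) (hab : a ≠ b)
    (hcover : ∀ j : Fin 4, j = 0 ∨ j = c ∨ j = a ∨ j = b) (hodd : Odd (ρ a + ρ b)) : Q = 0 := by
  refine eq_zero_of_forall_generic fun A hA => ?_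
  have hA0 : B (A 0) (A 0) ≠ 0 := by simpa using hA 0
  have hA1 : B (gs₁ A) (gs₁ A) ≠ 0 := by simpa using hA 1
  have hA2 : B (gs₂ A) (gs₂ A) ≠ 0 := by simpa using hA 2
  have hval := eval_gs (ρ := ρ) h3 h4 A hA0 hA1 hA2
  -- the flip
  have hflip := eval_flip h1 h2 (gs A) hc
    (mul_ne_zero (det_ne_zero_of_B (hA 0)) (det_ne_zero_of_B (hA c)))
    (fun j hj0 hjc => ⟨B_gs_eq_zero A (Ne.symm hj0), B_gs_eq_zero A (Ne.symm hjc)⟩)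
    (B_gs_eq_zero A hc.symm)
  -- the flipped tuple as two scalings by `-1`
  have hupd : (fun j => if j = 0 ∨ j = c then gs A j else -gs A j) =
      Function.update (Function.update (gs A) a ((-1 : k) • gs A a)) b
        ((-1 : k) • Function.update (gs A) a ((-1 : k) • gs A a) b) := by
    funext j
    rcases hcover j with h | h | h | h
    · subst h
      rw [if_pos (Or.inl rfl), Function.update_of_ne (Ne.symm hb), Function.update_of_ne (Ne.symm ha)]
    · subst h
      rw [if_pos (Or.inr rfl), Function.update_of_ne (Ne.symm hbc), Function.update_of_ne (Ne.symm hac)]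
    · subst h
      rw [if_neg (not_or.2 ⟨ha, hac⟩), Function.update_of_ne hab, Function.update_self, neg_one_smul]
    · subst h
      rw [if_neg (not_or.2 ⟨hb, hbc⟩), Function.update_self, Function.update_of_ne (Ne.symm hab),
        neg_one_smul]
  rw [hupd, eval_update_smul h4, eval_update_smul h4, ← mul_assoc, ← pow_add, add_comm,
    hodd.neg_one_pow] at hflip
  -- `-v = v` forces `v = 0` in characteristic `0`
  have hT0 : eval (pt (gs A)) Q = 0 := by
    have : (2 : k) * eval (pt (gs A)) Q = 0 := by linear_combination -hflip
    exact (mul_eq_zero.1 this).resolve_left two_ne_zero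
  rw [hT0, eq_comm, mul_eq_zero, mul_eq_zero, mul_eq_zero] at hval
  exact ((hval.resolve_left (pow_ne_zero _ (mul_ne_zero (mul_ne_zero hA0 hA1) hA2))).resolve_left
    (pow_ne_zero _ (mul_ne_zero hA0 hA1))).resolve_left (pow_ne_zero _ hA0)

/-- The central element `(-1, 1) ∈ SL₂ × SL₂` against multihomogeneity: the total degree is even
unless `Q = 0`. [cite: GoodmanWallachGTM255, §2.3.1] -/
theorem eq_zero_of_odd_sum (h1 : ∀ g : M2 k, g.det = 1 → subst₁ g Q = Q)
    (h4 : ∀ j, Q ∈ weightedHomogeneousSubmodule k (colWt j) (ρ j))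
    (hodd : Odd (ρ 0 + ρ 1 + ρ 2 + ρ 3)) : Q = 0 := by
  refine MvPolynomial.funext fun x => ?_
  rw [map_zero]
  set A := tupleOf x with hA
  have hx : x = pt A := by rw [hA, pt_tupleOf]
  have hneg := eval_left h1 (g := (-1 : M2 k)) (by simp [det_neg, Fintype.card_fin]) A
  have hupd : (fun j => (-1 : M2 k) * A j) =
      Function.update (Function.update (Function.update (Function.update A 0 ((-1 : k) • A 0)) 1
        ((-1 : k) • Function.update A 0 ((-1 : k) • A 0) 1)) 2
        ((-1 : k) • Function.update (Function.update A 0 ((-1 : k) • A 0)) 1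
          ((-1 : k) • Function.update A 0 ((-1 : k) • A 0) 1) 2)) 3
        ((-1 : k) • Function.update (Function.update (Function.update A 0 ((-1 : k) • A 0)) 1
          ((-1 : k) • Function.update A 0 ((-1 : k) • A 0) 1)) 2
          ((-1 : k) • Function.update (Function.update A 0 ((-1 : k) • A 0)) 1
            ((-1 : k) • Function.update A 0 ((-1 : k) • A 0) 1) 2) 3) := by
    funext j
    fin_cases j <;> simp
  rw [hupd, eval_update_smul h4, eval_update_smul h4, eval_update_smul h4, eval_update_smul h4,
    ← mul_assoc, ← mul_assoc, ← mul_assoc, ← pow_add, ← pow_add, ← pow_add,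
    show ρ 3 + ρ 2 + ρ 1 + ρ 0 = ρ 0 + ρ 1 + ρ 2 + ρ 3 by ring, hodd.neg_one_pow] at hneg
  rw [hx]
  have : (2 : k) * eval (pt A) Q = 0 := by linear_combination -hneg
  exact (mul_eq_zero.1 this).resolve_left two_ne_zero

/-- **Theorem A (parity).** A nonzero `SL₂ × SL₂ × U₄`-semi-invariant of multidegree `π` has
`π₀ ≡ π₁ ≡ π₂ ≡ π₃ (mod 2)`; equivalently (BLMW 2011 Prop. 8.1, vanishing half): the rectangular
Kronecker coefficient `g((δ,δ),(δ,δ),π)` vanishes unless `π` is even, or odd with four parts.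
[cite: BurgisserEtAl2011, §8.3 Prop. 8.1] -/
theorem parity_of_ne_zero (h1 : ∀ g : M2 k, g.det = 1 → subst₁ g Q = Q)
    (h2 : ∀ g : M2 k, g.det = 1 → subst₂ g Q = Q)
    (h3 : ∀ a b : Fin 4, a < b → ∀ t : k, shear₃ a b t Q = Q)
    (h4 : ∀ j, Q ∈ weightedHomogeneousSubmodule k (colWt j) (ρ j)) (hQ : Q ≠ 0) (j : Fin 4) :
    ρ j % 2 = ρ 0 % 2 := by
  have e23 : ¬ Odd (ρ 2 + ρ 3) := fun h =>
    hQ (eq_zero_of_odd_pair h1 h2 h3 h4 (c := 1) (a := 2) (b := 3) (by decide) (by decide) (by decide)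
      (by decide) (by decide) (by decide) (by decide) h)
  have e13 : ¬ Odd (ρ 1 + ρ 3) := fun h =>
    hQ (eq_zero_of_odd_pair h1 h2 h3 h4 (c := 2) (a := 1) (b := 3) (by decide) (by decide) (by decide)
      (by decide) (by decide) (by decide) (by decide) h)
  have e12 : ¬ Odd (ρ 1 + ρ 2) := fun h =>
    hQ (eq_zero_of_odd_pair h1 h2 h3 h4 (c := 3) (a := 1) (b := 2) (by decide) (by decide) (by decide)
      (by decide) (by decide) (by decide) (by decide) h)
  have esum : ¬ Odd (ρ 0 + ρ 1 + ρ 2 + ρ 3) := fun h => hQ (eq_zero_of_odd_sum h1 h4 h)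
  have f23 : (ρ 2 + ρ 3) % 2 = 0 := Nat.even_iff.1 (Nat.not_odd_iff_even.1 e23)
  have f13 : (ρ 1 + ρ 3) % 2 = 0 := Nat.even_iff.1 (Nat.not_odd_iff_even.1 e13)
  have f12 : (ρ 1 + ρ 2) % 2 = 0 := Nat.even_iff.1 (Nat.not_odd_iff_even.1 e12)
  have fsum : (ρ 0 + ρ 1 + ρ 2 + ρ 3) % 2 = 0 := Nat.even_iff.1 (Nat.not_odd_iff_even.1 esum)
  fin_cases j <;> simp <;> omega

end Parity

/-! ### §7 Normal forms and Theorem B: multiplicity one -/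

section NormalForm

variable [CharZero k] [IsAlgClosed k]

/-- Diagonalising a traceless anisotropic `2 × 2` matrix inside `SL₂`, the case `y₀₁ ≠ 0` (explicit
eigenvectors). [cite: GoodmanWallachGTM255, §2.3.1] -/
private theorem exists_conj_eq_diag_aux (y : M2 k) (htr : y 0 0 + y 1 1 = 0) (hdet : y.det ≠ 0)
    (h01 : y 0 1 ≠ 0) :
    ∃ (P : M2 k) (e : k), P.det = 1 ∧ e ≠ 0 ∧ P * y * adjugate P = !![e, 0; 0, -e] := by
  obtain ⟨e, he⟩ := IsAlgClosed.exists_eq_mul_self (-y.det)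
  have he0 : e ≠ 0 := by rintro rfl; apply hdet; linear_combination -he
  have hy11 : y 1 1 = -y 0 0 := by linear_combination htr
  have hee : e * e = y 0 0 * y 0 0 + y 0 1 * y 1 0 := by rw [← he, det_fin_two, hy11]; ring
  -- eigenvector matrix and the intertwining relation
  set H : M2 k := !![y 0 1, y 0 1; e - y 0 0, -e - y 0 0] with hH
  have hyH : y * H = H * !![e, 0; 0, -e] := by
    rw [Matrix.eta_fin_two y, hH, Matrix.mul_fin_two, Matrix.mul_fin_two, hy11]
    ext i j
    fin_cases i <;> fin_cases j
    · simp; ring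
    · simp; ring
    · simp; linear_combination -hee
    · simp; linear_combination -hee
  have hdetH : H.det = -(2 * e * y 0 1) := by rw [hH, det_fin_two_of]; ring
  have hdetH0 : H.det ≠ 0 := by
    rw [hdetH, neg_ne_zero]; exact mul_ne_zero (mul_ne_zero two_ne_zero he0) h01
  obtain ⟨μ, hμ⟩ := IsAlgClosed.exists_eq_mul_self H.det
  have hμ0 : μ ≠ 0 := by rintro rfl; exact hdetH0 (by rw [hμ, mul_zero])
  refine ⟨μ⁻¹ • adjugate H, e, ?_, he0, ?_⟩
  · rw [det_smul, det_adjugate, Fintype.card_fin, pow_one, hμ]; field_simp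
  · rw [adjugate_smul, Fintype.card_fin, pow_one, adjugate_adjugate _ (by simp), Fintype.card_fin,
      pow_zero, one_smul, Matrix.smul_mul, Matrix.smul_mul, Matrix.mul_smul, smul_smul,
      Matrix.mul_assoc, hyH, ← Matrix.mul_assoc, adjugate_mul, Matrix.smul_mul, Matrix.one_mul,
      smul_smul, hμ]
    field_simp
    rw [one_smul]

/-- **Diagonalisation inside `SL₂`.** A traceless `2 × 2` matrix with nonzero determinant over an
algebraically closed field of characteristic `0` is `SL₂`-conjugate to `diag(e, -e)`, `e ≠ 0`.
[cite: GoodmanWallachGTM255, §2.3.1] -/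
theorem exists_conj_eq_diag (y : M2 k) (htr : y 0 0 + y 1 1 = 0) (hdet : y.det ≠ 0) :
    ∃ (P : M2 k) (e : k), P.det = 1 ∧ e ≠ 0 ∧ P * y * adjugate P = !![e, 0; 0, -e] := by
  by_cases h01 : y 0 1 ≠ 0
  · exact exists_conj_eq_diag_aux y htr hdet h01
  rw [not_ne_iff] at h01
  by_cases h10 : y 1 0 ≠ 0
  · -- conjugate by the Weyl element first
    set w : M2 k := !![0, 1; -1, 0] with hw
    have hdw : w.det = 1 := by rw [hw, det_fin_two_of]; ring
    set y' : M2 k := w * y * adjugate w with hy'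
    have hy'e : y' = !![y 1 1, -y 1 0; -y 0 1, y 0 0] := by
      rw [hy', hw, adjugate_fin_two_of, Matrix.eta_fin_two y, Matrix.mul_fin_two, Matrix.mul_fin_two]
      ext i j; fin_cases i <;> fin_cases j <;> simp
    have htr' : y' 0 0 + y' 1 1 = 0 := by rw [hy'e]; simp; linear_combination htr
    have hdet' : y'.det ≠ 0 := by
      rw [hy', det_mul, det_mul, det_adjugate, hdw]; simpa using hdet
    have h01' : y' 0 1 ≠ 0 := by rw [hy'e]; simpa using h10
    obtain ⟨P, e, hP, he, hconj⟩ := exists_conj_eq_diag_aux y' htr' hdet' h01'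
    refine ⟨P * w, e, by rw [det_mul, hP, hdw, mul_one], he, ?_⟩
    rw [adjugate_mul_distrib, ← hconj, hy']
    simp only [Matrix.mul_assoc]
  · rw [not_ne_iff] at h10
    have hy11 : y 1 1 = -y 0 0 := by linear_combination htr
    have h00 : y 0 0 ≠ 0 := by
      intro h; apply hdet; rw [det_fin_two, h01, h10, hy11, h]; ring
    refine ⟨1, y 0 0, det_one, h00, ?_⟩
    rw [adjugate_one, Matrix.one_mul, Matrix.mul_one]
    ext i j
    fin_cases i <;> fin_cases j <;> simp [h01, h10, hy11]

/-- The normal form tuple `(a·1, diag(e,-e), antidiag(q,r), s·antidiag(q,-r))` with parameters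
`p = (a, e, q, r, s)`. [cite: GoodmanWallachGTM255, §2.3.1] -/
def nf (p : Fin 5 → k) : Fin 4 → M2 k :=
  ![p 0 • (1 : M2 k), !![p 1, 0; 0, -p 1], !![0, p 2; p 3, 0], p 4 • !![0, p 2; -p 3, 0]]

/-- **Normal form.** A `B`-orthogonal tuple of anisotropic matrices is moved by `SL₂ × SL₂` to a normal
form `nf p` with `p₂ p₃ ≠ 0`. [cite: GoodmanWallachGTM255, §2.3.1] -/
theorem exists_normalForm (T : Fin 4 → M2 k) (horth : ∀ i j, i ≠ j → B (T i) (T j) = 0)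
    (han : ∀ j, B (T j) (T j) ≠ 0) :
    ∃ (P R : M2 k) (p : Fin 5 → k), P.det = 1 ∧ R.det = 1 ∧ p 2 ≠ 0 ∧ p 3 ≠ 0 ∧
      (fun j => P * T j * R) = nf p := by
  -- step (i): make `T 0` scalar
  obtain ⟨γ, hγ⟩ := IsAlgClosed.exists_eq_mul_self (T 0).det
  have hd0 : (T 0).det ≠ 0 := det_ne_zero_of_B (han 0)
  have hγ0 : γ ≠ 0 := by rintro rfl; exact hd0 (by rw [hγ, mul_zero])
  set P₁ : M2 k := γ⁻¹ • adjugate (T 0) with hP₁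
  have hdP₁ : P₁.det = 1 := by
    rw [hP₁, det_smul, det_adjugate, Fintype.card_fin, pow_one, hγ]; field_simp
  set U : Fin 4 → M2 k := fun j => P₁ * T j with hU
  have hU0 : U 0 = γ • (1 : M2 k) := by
    simp only [hU, hP₁, Matrix.smul_mul, adjugate_mul, smul_smul, hγ]
    congr 1; field_simp
  have hBU : ∀ i j, B (U i) (U j) = B (T i) (T j) := by
    intro i j
    have := B_mul_mul P₁ (T i) (T j) 1
    rwa [Matrix.mul_one, Matrix.mul_one, hdP₁, det_one, one_mul, one_mul] at this
  have htrU : ∀ j, j ≠ 0 → U j 0 0 + U j 1 1 = 0 := by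
    intro j hj
    have h := hBU 0 j
    rw [horth 0 j hj.symm, hU0, B_smul_left, B] at h
    simp only [Matrix.one_apply_eq, Matrix.one_apply_ne (show (0 : Fin 2) ≠ 1 by decide),
      Matrix.one_apply_ne (show (1 : Fin 2) ≠ 0 by decide), one_mul, zero_mul, sub_zero] at h
    have := (mul_eq_zero.1 h).resolve_left hγ0
    linear_combination this
  -- step (ii): diagonalise `U 1`
  have hdU1 : (U 1).det ≠ 0 := by
    rw [hU]; simp only [det_mul, hdP₁, one_mul]; exact det_ne_zero_of_B (han 1)
  obtain ⟨P₂, e, hdP₂, he0, hdiag⟩ := exists_conj_eq_diag (U 1) (htrU 1 (by decide)) hdU1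
  set V : Fin 4 → M2 k := fun j => P₂ * U j * adjugate P₂ with hV
  have hV0 : V 0 = γ • (1 : M2 k) := by
    simp only [hV, hU0, Matrix.mul_smul, Matrix.mul_one, Matrix.smul_mul, mul_adjugate, hdP₂, one_smul]
  have hV1 : V 1 = !![e, 0; 0, -e] := hdiag
  have hBV : ∀ i j, B (V i) (V j) = B (T i) (T j) := by
    intro i j
    rw [hV]
    simp only
    rw [B_mul_mul, det_adjugate, hdP₂, one_pow, one_mul, one_mul, hBU]
  have htrV : ∀ j, j ≠ 0 → V j 0 0 + V j 1 1 = 0 := by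
    intro j hj
    have h := hBV 0 j
    rw [horth 0 j hj.symm, hV0, B_smul_left, B] at h
    simp only [Matrix.one_apply_eq, Matrix.one_apply_ne (show (0 : Fin 2) ≠ 1 by decide),
      Matrix.one_apply_ne (show (1 : Fin 2) ≠ 0 by decide), one_mul, zero_mul, sub_zero] at h
    have := (mul_eq_zero.1 h).resolve_left hγ0
    linear_combination this
  -- step (iii): the shape of `V 2`, `V 3`
  have shape : ∀ j, j ≠ 0 → j ≠ 1 → V j = !![0, V j 0 1; V j 1 0, 0] := by
    intro j hj0 hj1
    have h := hBV 1 j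
    rw [horth 1 j hj1.symm, hV1, B] at h
    simp at h
    have ht := htrV j hj0
    have h00 : V j 0 0 = 0 := by
      have : e * (V j 1 1 - V j 0 0) = 0 := by linear_combination h
      have h2 := (mul_eq_zero.1 this).resolve_left he0
      linear_combination (ht - h2) / 2
    have h11 : V j 1 1 = 0 := by linear_combination ht - h00
    ext a b
    fin_cases a <;> fin_cases b <;> simp [h00, h11]
  set q := V 2 0 1 with hq
  set r := V 2 1 0 with hr
  have hV2 : V 2 = !![0, q; r, 0] := shape 2 (by decide) (by decide)
  have hB22 : B (V 2) (V 2) = -(2 * (q * r)) := by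
    rw [hV2, B]; simp; ring
  have hqr : q * r ≠ 0 := by
    intro h0
    apply han 2
    rw [← hBV 2 2, hB22, h0, mul_zero, neg_zero]
  have hq0 : q ≠ 0 := left_ne_zero_of_mul hqr
  have hr0 : r ≠ 0 := right_ne_zero_of_mul hqr
  have hV3 : V 3 = (V 3 0 1 / q) • !![0, q; -r, 0] := by
    have h3 := shape 3 (by decide) (by decide)
    have h := hBV 2 3
    rw [horth 2 3 (by decide), hV2, h3, B] at h
    simp at h
    -- `h : 0 = -(q * V 3 1 0) - r * V 3 0 1` up to normalisation
    rw [h3]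
    ext i j
    fin_cases i <;> fin_cases j
    · simp
    · simp; field_simp
    · simp; field_simp; linear_combination -h
    · simp
  refine ⟨P₂ * P₁, adjugate P₂, ![γ, e, q, r, V 3 0 1 / q], by rw [det_mul, hdP₂, hdP₁, mul_one],
    by rw [det_adjugate, hdP₂, one_pow], hq0, hr0, ?_⟩
  funext j
  have hj : P₂ * P₁ * T j * adjugate P₂ = V j := by simp only [hV, hU, Matrix.mul_assoc]
  rw [hj]
  fin_cases j
  · simpa [nf] using hV0
  · simpa [nf] using hV1
  · simpa [nf] using hV2
  · simpa [nf] using hV3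

/-- The normal form `nf p` (`p₂ p₃ ≠ 0`) lies in the orbit of the test tuple under `SL₂ × SL₂` and the
column scalings: `nf p = (c_j · D x⁰_j adj D)_j` with `D = diag(μ, μ⁻¹)`.
[cite: GoodmanWallachGTM255, §2.3.1] -/
theorem exists_nf_eq_testTuple {p : Fin 5 → k} (hp2 : p 2 ≠ 0) (hp3 : p 3 ≠ 0) :
    ∃ (D : M2 k) (c : Fin 4 → k), D.det = 1 ∧
      nf p = fun j => c j • (D * testTuple j * adjugate D) := by
  -- `μ⁴ = p₂ / p₃`, `λ = p₃ μ²` so that `λ μ² = p₂`, `λ μ⁻² = p₃`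
  obtain ⟨μ, hμ⟩ := IsAlgClosed.exists_pow_nat_eq (p 2 / p 3) (show 0 < 4 by norm_num)
  have hμ0 : μ ≠ 0 := by
    have : μ ^ 4 ≠ 0 := by rw [hμ]; exact div_ne_zero hp2 hp3
    exact fun h => this (by rw [h]; norm_num)
  set lam : k := p 3 * μ ^ 2 with hlam
  have h1 : lam * μ ^ 2 = p 2 := by
    rw [hlam, mul_assoc, ← pow_add, show 2 + 2 = 4 by norm_num, hμ]; field_simp
  have h2 : lam * (μ⁻¹) ^ 2 = p 3 := by rw [hlam]; field_simp
  refine ⟨!![μ, 0; 0, μ⁻¹], ![p 0, p 1, lam, p 4 * lam], ?_, ?_⟩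
  · rw [det_fin_two_of, mul_zero, sub_zero, mul_inv_cancel₀ hμ0]
  have hD : adjugate (!![μ, 0; 0, μ⁻¹] : M2 k) = !![μ⁻¹, 0; 0, μ] := by
    rw [adjugate_fin_two_of]; simp
  funext j
  fin_cases j
  · show nf p 0 = p 0 • (!![μ, 0; 0, μ⁻¹] * testTuple 0 * adjugate !![μ, 0; 0, μ⁻¹])
    rw [hD, nf, testTuple]
    simp only [Matrix.cons_val_zero, Matrix.mul_one]
    rw [Matrix.mul_fin_two]
    ext i j; fin_cases i <;> fin_cases j <;> simp [hμ0]
  · show nf p 1 = p 1 • (!![μ, 0; 0, μ⁻¹] * testTuple 1 * adjugate !![μ, 0; 0, μ⁻¹])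
    rw [hD, nf, testTuple]
    simp only [Matrix.cons_val_one, Matrix.cons_val_zero, Matrix.mul_fin_two]
    ext i j; fin_cases i <;> fin_cases j <;> simp [hμ0]
  · show nf p 2 = lam • (!![μ, 0; 0, μ⁻¹] * testTuple 2 * adjugate !![μ, 0; 0, μ⁻¹])
    rw [hD, nf, testTuple]
    simp only [Matrix.cons_val, Matrix.mul_fin_two]
    ext i j; fin_cases i <;> fin_cases j
    · simp
    · simp; rw [← h1]; ring
    · simp; rw [← h2]; ring
    · simp
  · show nf p 3 = (p 4 * lam) • (!![μ, 0; 0, μ⁻¹] * testTuple 3 * adjugate !![μ, 0; 0, μ⁻¹])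
    rw [hD, nf, testTuple]
    simp only [Matrix.cons_val, Matrix.mul_fin_two]
    ext i j; fin_cases i <;> fin_cases j
    · simp
    · simp; rw [← h1]; ring
    · simp; rw [← h2]; ring
    · simp

end NormalForm

section MultiplicityOne

variable [CharZero k] [IsAlgClosed k] {Q : MvPolynomial Idx k} {ρ : Fin 4 → ℕ}

/-- **A semi-invariant is determined, on the generic locus, by its value at the test tuple.**
For a generic tuple `A` there is `κ` with `Q(A) = κ · Q(x⁰)`. [cite: GoodmanWallachGTM255, §2.3.1] -/
theorem exists_eval_eq_mul_eval_testTuple (h1 : ∀ g : M2 k, g.det = 1 → subst₁ g Q = Q)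
    (h2 : ∀ g : M2 k, g.det = 1 → subst₂ g Q = Q)
    (h3 : ∀ a b : Fin 4, a < b → ∀ t : k, shear₃ a b t Q = Q)
    (h4 : ∀ j, Q ∈ weightedHomogeneousSubmodule k (colWt j) (ρ j)) (A : Fin 4 → M2 k)
    (hA : ∀ j, B (gs A j) (gs A j) ≠ 0) :
    ∃ κ : k, eval (pt A) Q = κ * eval (pt testTuple) Q := by
  have hA0 : B (A 0) (A 0) ≠ 0 := by simpa using hA 0
  have hA1 : B (gs₁ A) (gs₁ A) ≠ 0 := by simpa using hA 1
  have hA2 : B (gs₂ A) (gs₂ A) ≠ 0 := by simpa using hA 2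
  have hval := eval_gs (ρ := ρ) h3 h4 A hA0 hA1 hA2
  obtain ⟨P, R, p, hP, hR, hp2, hp3, hnf⟩ :=
    exists_normalForm (gs A) (fun i j hij => B_gs_eq_zero A hij) hA
  obtain ⟨D, c, hD, hnfx⟩ := exists_nf_eq_testTuple hp2 hp3
  -- `Q(gs A) = Q(nf p) = (Π c^ρ) Q(D x⁰ adj D) = (Π c^ρ) Q(x⁰)`
  have e1 : eval (pt (gs A)) Q = eval (pt (nf p)) Q := by
    rw [← hnf]
    have ea := eval_left h1 hP (fun j => gs A j * R)
    have eb := eval_right h2 hR (gs A)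
    simp only [← Matrix.mul_assoc] at ea
    rw [ea, eb]
  have e2 : eval (pt (nf p)) Q = (c 0 ^ ρ 0 * c 1 ^ ρ 1 * c 2 ^ ρ 2 * c 3 ^ ρ 3) *
      eval (pt testTuple) Q := by
    rw [hnfx, eval_smul_all h4]
    have ea := eval_left h1 hD (fun j => testTuple j * adjugate D)
    have eb := eval_right h2 (by rw [det_adjugate, hD, one_pow]) (testTuple (k := k))
    simp only [← Matrix.mul_assoc] at ea
    rw [ea, eb]
  set K := (B (A 0) (A 0) * B (gs₁ A) (gs₁ A) * B (gs₂ A) (gs₂ A)) ^ ρ 3 *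
      ((B (A 0) (A 0) * B (gs₁ A) (gs₁ A)) ^ ρ 2 * B (A 0) (A 0) ^ ρ 1) with hK
  have hK0 : K ≠ 0 := mul_ne_zero (pow_ne_zero _ (mul_ne_zero (mul_ne_zero hA0 hA1) hA2))
    (mul_ne_zero (pow_ne_zero _ (mul_ne_zero hA0 hA1)) (pow_ne_zero _ hA0))
  refine ⟨K⁻¹ * (c 0 ^ ρ 0 * c 1 ^ ρ 1 * c 2 ^ ρ 2 * c 3 ^ ρ 3), ?_⟩
  have hKe : eval (pt (gs A)) Q = K * eval (pt A) Q := by rw [hval, hK]; ring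
  calc eval (pt A) Q = K⁻¹ * (K * eval (pt A) Q) := by
        rw [← mul_assoc, inv_mul_cancel₀ hK0, one_mul]
    _ = K⁻¹ * eval (pt (gs A)) Q := by rw [hKe]
    _ = _ := by rw [e1, e2]; ring

/-- A semi-invariant vanishing at the test tuple vanishes identically.
[cite: GoodmanWallachGTM255, §2.3.1] -/
theorem eq_zero_of_eval_testTuple (h1 : ∀ g : M2 k, g.det = 1 → subst₁ g Q = Q)
    (h2 : ∀ g : M2 k, g.det = 1 → subst₂ g Q = Q)
    (h3 : ∀ a b : Fin 4, a < b → ∀ t : k, shear₃ a b t Q = Q)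
    (h4 : ∀ j, Q ∈ weightedHomogeneousSubmodule k (colWt j) (ρ j))
    (h0 : eval (pt testTuple) Q = 0) : Q = 0 :=
  eq_zero_of_forall_generic fun A hA => by
    obtain ⟨κ, hκ⟩ := exists_eval_eq_mul_eval_testTuple h1 h2 h3 h4 A hA
    rw [hκ, h0, mul_zero]

/-- **Theorem B (multiplicity one).** Two `SL₂ × SL₂ × U₄`-semi-invariants of the same multidegree are
proportional: `Q₁(x⁰) · Q₂ = Q₂(x⁰) · Q₁`. Equivalently (BLMW 2011 Prop. 8.1, multiplicity part)
`g((δ,δ),(δ,δ),π) ≤ 1`. [cite: BurgisserEtAl2011, §8.3 Prop. 8.1] -/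
theorem smul_eq_smul_of_semiInvariant {Q₁ Q₂ : MvPolynomial Idx k}
    (h1 : ∀ g : M2 k, g.det = 1 → subst₁ g Q₁ = Q₁) (h2 : ∀ g : M2 k, g.det = 1 → subst₂ g Q₁ = Q₁)
    (h3 : ∀ a b : Fin 4, a < b → ∀ t : k, shear₃ a b t Q₁ = Q₁)
    (h4 : ∀ j, Q₁ ∈ weightedHomogeneousSubmodule k (colWt j) (ρ j))
    (h1' : ∀ g : M2 k, g.det = 1 → subst₁ g Q₂ = Q₂) (h2' : ∀ g : M2 k, g.det = 1 → subst₂ g Q₂ = Q₂)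
    (h3' : ∀ a b : Fin 4, a < b → ∀ t : k, shear₃ a b t Q₂ = Q₂)
    (h4' : ∀ j, Q₂ ∈ weightedHomogeneousSubmodule k (colWt j) (ρ j)) :
    eval (pt testTuple) Q₁ • Q₂ = eval (pt testTuple) Q₂ • Q₁ := by
  set c₁ := eval (pt testTuple) Q₁
  set c₂ := eval (pt testTuple) Q₂
  rw [← sub_eq_zero]
  refine eq_zero_of_eval_testTuple (ρ := ρ) (fun g hg => ?_) (fun g hg => ?_) (fun a b hab t => ?_)
    (fun j => ?_) ?_
  · rw [map_sub, map_smul, map_smul, h1 g hg, h1' g hg]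
  · rw [map_sub, map_smul, map_smul, h2 g hg, h2' g hg]
  · rw [map_sub, map_smul, map_smul, h3 a b hab t, h3' a b hab t]
  · exact Submodule.sub_mem _ (Submodule.smul_mem _ _ (h4' j)) (Submodule.smul_mem _ _ (h4 j))
  · rw [map_sub, smul_eval, smul_eval]; ring

/-- **Theorem B, quotient form.** If `Q₁ ≠ 0` then every semi-invariant of the same multidegree is a
scalar multiple of `Q₁`. [cite: BurgisserEtAl2011, §8.3 Prop. 8.1] -/
theorem exists_smul_eq_of_semiInvariant {Q₁ Q₂ : MvPolynomial Idx k}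
    (h1 : ∀ g : M2 k, g.det = 1 → subst₁ g Q₁ = Q₁) (h2 : ∀ g : M2 k, g.det = 1 → subst₂ g Q₁ = Q₁)
    (h3 : ∀ a b : Fin 4, a < b → ∀ t : k, shear₃ a b t Q₁ = Q₁)
    (h4 : ∀ j, Q₁ ∈ weightedHomogeneousSubmodule k (colWt j) (ρ j))
    (h1' : ∀ g : M2 k, g.det = 1 → subst₁ g Q₂ = Q₂) (h2' : ∀ g : M2 k, g.det = 1 → subst₂ g Q₂ = Q₂)
    (h3' : ∀ a b : Fin 4, a < b → ∀ t : k, shear₃ a b t Q₂ = Q₂)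
    (h4' : ∀ j, Q₂ ∈ weightedHomogeneousSubmodule k (colWt j) (ρ j)) (hQ₁ : Q₁ ≠ 0) :
    ∃ c : k, Q₂ = c • Q₁ := by
  have hc : eval (pt testTuple) Q₁ ≠ 0 := fun h => hQ₁ (eq_zero_of_eval_testTuple h1 h2 h3 h4 h)
  have h := smul_eq_smul_of_semiInvariant (ρ := ρ) h1 h2 h3 h4 h1' h2' h3' h4'
  refine ⟨(eval (pt testTuple) Q₁)⁻¹ * eval (pt testTuple) Q₂, ?_⟩
  rw [mul_smul, ← h, smul_smul, inv_mul_cancel₀ hc, one_smul]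

end MultiplicityOne

end Literature.RepresentationTheory.ClassicalInvariants.TwoByTwoTuple

end
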